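import Summits.QuantumFields.YangMills.Theorems.UnitScaleTiltHalvingStepOfPillarsCEPair
import Summits.QuantumFields.YangMills.Theorems.UnitScaleTiltHalvingCompetitorMapAction
import Summits.QuantumFields.YangMills.Theorems.UnitScaleTiltProp8ChartKernelFlatTower
import HarnessLib

/-!
# Route `UnitScaleTilt`, crux K1 «MinimiserStabilityRegPr» (stmt-QuantumFields-19200), stub V2′ `stub_halvingStep` — (K-E2E) door, C_E end, lemma L2′:
# **HYPOTHESIS (i) OF THE (165)-A₁ ROW FROM THE ROUTE'S MINIMALITY THROUGH THE LOCALISED COMPETITOR MAP** (LEAD ★w5-19200 g4 RULING L-1 (R3) «localise the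
# competitor map»; supersedes the global-chart hypothesis (Φ-2) of ✓`hpair_of_hcrit` (L2), which no pillar supplies off the region)

Cell `ym3-torus` (HUMAN RULING D-0037: rung R3, not Clay), width seat `ym-ust-19200-w8` g0∕s2.  `--supports stmt-QuantumFields-19200 --as helper`; def-free, 0 sorry.

WHAT.  ✓`HalvingCompetitorMapAction.tracePairing_of_isMinOn_localChart` (★w1-19200 g7, FILE A §4) at the competitor set `T = {X : 𝔰𝔲(2)-valued, Q X = Q A on the
index bonds of `Dm`, X in the r₁-ball}` and the LOCAL competitor map `Φloc X b := if Near b then Uc (X − H(D X)) b else (uS • Umin) b` (the exponential chart on the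
`Near` bonds, the minimiser's gauge copy elsewhere), with EVERYTHING but two residues discharged:
* `hexp` (the chart on the four sides of every `Tch`-plaquette) from `hTN : Tch p → its sides are Near`;
* `hoff` (census (L1), the PINNING off the `Tch`-plaquettes) from `hTF : ¬Tch p → its sides lie in Λ₀` (`Dm.LamBond 0`): a level-`0` index datum IS the bond value
  (`bondAvgIter_zero`), so every competitor equals `A` there; and THE LEVEL-0 DRESSING VANISHES on the ball — (49) at a level-`0` index reads
  `D X (0,b) = −i·log(e^{iη♭Z_b}) − η♭Z_b = 0` (✓`ChartKernelFlat.logTower_zero`, window `‖η♭Z_b‖ ≤ w₁(b)‖Z_b‖ < R ≤ 1/5` from `hball`, `hR`), whence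
  `(H(D X)) b = η♭⁻¹•(D X)(0,b) = 0` by `hHinv` (print's `Q♭'(0) ∘ H = id` at level `0`) and the dressed competitor equals `A` on Λ₀ too;
* `hΨsa` by ✓`dressed_competitor_su2`, `hS₀` by ✓`exists_lineRadius_of_mem_weightedBall`, `hD` by FILE E's differentiability shape, `hAQ` by `rfl`;
* `hmin` by ✓`HalvingHcritTransfer.hmin_of_hcrit_eq` applied to `X ↦ uS⁻¹ • Φloc X` (`Φloc A = uS • Umin` by the REGIONAL chart identity, so `uS⁻¹ • Φloc A = Umin`;
  `wilsonAction_gaugeAct`).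
DISPLAYED (both inhabitable, unlike a global chart): (Φ-2′) `hchartNear : ∀ b, Near b → ↑((uS • Umin) b) = e^{iη(A − H(D A))(b)}` — the chart identity on the Near
bonds only (P1♭ (ii) on the sides of the plaquettes touching `Ω₁`, after the `U(2) → SU(2)` normalisation) — and (Φ-1′) `hΦ1 : ∀ X ∈ T, uS⁻¹ • Φloc X ∈ regFibrePr`
(the fibre∕regularity half).  The geometry (`Near`, `Tch`, `hTN`, `hTF`) is abstract; the bundle takes `Tch p :↔ a corner of p is Deep 0`.
HONEST SCOPE: finite sums, first-order calculus and bookkeeping; NOT a claim about the stub, the crux, the rung or the gap.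

References: T. Bałaban, CMP **102** (1985) 277–309 [Balaban1985Variational] (44)–(49) p.285, (99) p.293, (150) p.301, (152) p.301, (157)–(158) p.302; CMP **99** (1985)
75–102 [Balaban1985RegularSpaces] p.77 (sides touching a set); CMP **96** (1984) 223–250 [Balaban1984PropagatorsII] (2.3)–(2.4) p.224 (`Λ₀ = Ω₁ᶜ` frozen).
-/

set_option autoImplicit false

noncomputable section

open scoped BigOperators Matrix Matrix.Norms.L2Operator
open NormedSpace

namespace Summit.QuantumFields.YangMills.Theorems.HalvingSitePackage

open Literature.MathematicalPhysics.QuantumFieldTheory.Balaban1983to89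
open Literature.MathematicalPhysics.QuantumFieldTheory.Balaban1983to89.T3ContinuumYM3Torus
open Literature.MathematicalPhysics.QuantumFieldTheory.Balaban1983to89.T3PrintedRegularMinimiser
open B6SectADomainsV1 (Domains)
open B6SectAOperatorsV1 (BondIdx QE)
open LatticeFieldCalculus (bondAvgIter)
open B5Eq120IterProof (bondAvgIter_zero)
open FlatCubeOpsText (IsLevWeight)
open FlatOpsLettersAssembly (flatH levWeight_nonneg)
open Prop8ChartDoubleBar (chartLogFlat chartLogFlat_apply fderiv_chartLogFlat_zero_apply dressed_competitor_su2 exists_lineRadius_of_mem_weightedBall)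

variable {F : T3Family} {n K : ℕ}

-- heartbeat budget (HOME README rule): > 60-line signature with two FILE-E-sized formula hypotheses; budgeted 400k on this declaration only
set_option maxHeartbeats 400000 in
/-- **L2′: (i) OF THE (165) ROW FROM `hcrit` THROUGH THE LOCALISED COMPETITOR MAP** — see the module docstring; `A` is the chart preimage (L1's `A′`), `H` the level-scaled
extension `Hs`, `D` the dressing map `Dsel` of FILE E, `Uc` an `SU(2)` chart of 𝔰𝔲(2)-valued fields (✓`exists_su2Chart`), `Near`∕`Tch` the charted bonds ∕ the plaquettes touching
the region, `uS` the gauge of the regional chart identity. [cite: Balaban1985Variational, (47)-(49) p.285, (99) p.293, (150) p.301, (157)-(158) p.302; Balaban1984PropagatorsII, (2.3)-(2.4) p.224] -/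
theorem hpair_of_hcrit_local (F : T3Family) (n K : ℕ) (Dm : Domains (F.P K)) (hDk : Dm.k = K - n)
    (hcollar : ∀ (i : ℕ) (e : PBond (F.P K) (i + 1)), Dm.LamBond (i + 1) e → ∀ z : Site (F.P K) i, (blockOf z = e.src ∨ blockOf z = e.tgt) → z ∈ Dm.Om i)
    {w : ℕ → PBond (F.P K) 0 → ℝ} (hw : IsLevWeight F n K Dm w)
    {R : ℝ} (hR : 16 * 3800 * ((((F.P K).d + 2) * (F.P K).L : ℕ) : ℝ) ^ 2 * (F.L : ℝ) * R ≤ 1)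
    (η : ℝ) (hη : η ≠ 0)
    (W₀ : (PBond (F.P K) 0 → Matrix (Fin 2) (Fin 2) ℂ) → (PBond (F.P K) 0 → Matrix (Fin 2) (Fin 2) ℂ)) (hSd : Differentiable ℂ (fun A : PBond (F.P K) 0 → Matrix (Fin 2) (Fin 2) ℂ => (∑ p : Plaq (F.P K) 0, (1 - (2 : ℂ)⁻¹ * Matrix.trace (exp ((Complex.I * (η : ℂ)) • A ⟨p.src, p.μ⟩) * exp ((Complex.I * (η : ℂ)) • A ⟨p.src.shift p.μ, p.ν⟩) * exp (-((Complex.I * (η : ℂ)) • A ⟨p.src.shift p.ν, p.μ⟩)) * exp (-((Complex.I * (η : ℂ)) • A ⟨p.src, p.ν⟩)))))))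
    (hgrad : ∀ A δ : PBond (F.P K) 0 → Matrix (Fin 2) (Fin 2) ℂ, fderiv ℂ (fun A : PBond (F.P K) 0 → Matrix (Fin 2) (Fin 2) ℂ => (∑ p : Plaq (F.P K) 0, (1 - (2 : ℂ)⁻¹ * Matrix.trace (exp ((Complex.I * (η : ℂ)) • A ⟨p.src, p.μ⟩) * exp ((Complex.I * (η : ℂ)) • A ⟨p.src.shift p.μ, p.ν⟩) * exp (-((Complex.I * (η : ℂ)) • A ⟨p.src.shift p.ν, p.μ⟩)) * exp (-((Complex.I * (η : ℂ)) • A ⟨p.src, p.ν⟩)))))) A δ =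
      ((η : ℂ) ^ 2 / 2) * ∑ p : Plaq (F.P K) 0, Matrix.trace ((A ⟨p.src, p.μ⟩ + A ⟨p.src.shift p.μ, p.ν⟩ - A ⟨p.src.shift p.ν, p.μ⟩ - A ⟨p.src, p.ν⟩) * (δ ⟨p.src, p.μ⟩ + δ ⟨p.src.shift p.μ, p.ν⟩ - δ ⟨p.src.shift p.ν, p.μ⟩ - δ ⟨p.src, p.ν⟩)) + (η : ℂ) ^ 4 * ∑ b : PBond (F.P K) 0, Matrix.trace (W₀ A b * δ b))
    (H : (BondIdx Dm → Matrix (Fin 2) (Fin 2) ℂ) →ₗ[ℂ] (PBond (F.P K) 0 → Matrix (Fin 2) (Fin 2) ℂ))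
    (hHs : ∀ X b, H X b = ∑ c, (flatH F n K Dm (Pi.single c 1) b * ((F.L : ℝ) ^ (c.1.1 : ℕ) * ((F.L : ℝ)⁻¹) ^ (K - n))⁻¹) • X c)
    (D : (PBond (F.P K) 0 → Matrix (Fin 2) (Fin 2) ℂ) → (BondIdx Dm → Matrix (Fin 2) (Fin 2) ℂ))
    (E : (PBond (F.P K) 0 → Matrix (Fin 2) (Fin 2) ℂ) → (PBond (F.P K) 0 → Matrix (Fin 2) (Fin 2) ℂ))
    (hE : ∀ (Y : PBond (F.P K) 0 → Matrix (Fin 2) (Fin 2) ℂ) (b : PBond (F.P K) 0) (i j : Fin 2), E Y b i j = ((η : ℂ) ^ 4)⁻¹ *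
      (-(((η : ℂ) ^ 2 / 2) * ∑ p : Plaq (F.P K) 0, Matrix.trace ((H (D Y) ⟨p.src, p.μ⟩ + H (D Y) ⟨p.src.shift p.μ, p.ν⟩ - H (D Y) ⟨p.src.shift p.ν, p.μ⟩ - H (D Y) ⟨p.src, p.ν⟩) *
          ((Pi.single b (Matrix.single j i (1 : ℂ)) : PBond (F.P K) 0 → Matrix (Fin 2) (Fin 2) ℂ) ⟨p.src, p.μ⟩ + (Pi.single b (Matrix.single j i (1 : ℂ)) : PBond (F.P K) 0 → Matrix (Fin 2) (Fin 2) ℂ) ⟨p.src.shift p.μ, p.ν⟩ -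
            (Pi.single b (Matrix.single j i (1 : ℂ)) : PBond (F.P K) 0 → Matrix (Fin 2) (Fin 2) ℂ) ⟨p.src.shift p.ν, p.μ⟩ - (Pi.single b (Matrix.single j i (1 : ℂ)) : PBond (F.P K) 0 → Matrix (Fin 2) (Fin 2) ℂ) ⟨p.src, p.ν⟩)))
        - ((η : ℂ) ^ 2 / 2) * ∑ p : Plaq (F.P K) 0, Matrix.trace (((Y - H (D Y)) ⟨p.src, p.μ⟩ + (Y - H (D Y)) ⟨p.src.shift p.μ, p.ν⟩ - (Y - H (D Y)) ⟨p.src.shift p.ν, p.μ⟩ - (Y - H (D Y)) ⟨p.src, p.ν⟩) *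
          (H (fderiv ℂ D Y (Pi.single b (Matrix.single j i (1 : ℂ)))) ⟨p.src, p.μ⟩ + H (fderiv ℂ D Y (Pi.single b (Matrix.single j i (1 : ℂ)))) ⟨p.src.shift p.μ, p.ν⟩ -
            H (fderiv ℂ D Y (Pi.single b (Matrix.single j i (1 : ℂ)))) ⟨p.src.shift p.ν, p.μ⟩ - H (fderiv ℂ D Y (Pi.single b (Matrix.single j i (1 : ℂ)))) ⟨p.src, p.ν⟩))
        - (η : ℂ) ^ 4 * ∑ b' : PBond (F.P K) 0, Matrix.trace (W₀ (Y - H (D Y)) b' * H (fderiv ℂ D Y (Pi.single b (Matrix.single j i (1 : ℂ)))) b')))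
    {r₁ t : ℝ}
    (h49 : ∀ X : PBond (F.P K) 0 → Matrix (Fin 2) (Fin 2) ℂ, (∀ b, w 1 b * ‖X b‖ < r₁) → (fun (Z : PBond (F.P K) 0 → Matrix (Fin 2) (Fin 2) ℂ) => chartLogFlat ((((F.L : ℝ))⁻¹) ^ (K - n)) Dm Z - (fderiv ℂ (chartLogFlat ((((F.L : ℝ))⁻¹) ^ (K - n)) Dm : (PBond (F.P K) 0 → Matrix (Fin 2) (Fin 2) ℂ) → BondIdx Dm → Matrix (Fin 2) (Fin 2) ℂ) 0) Z) (X - H (D X)) = D X)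
    (hsize : ∀ X : PBond (F.P K) 0 → Matrix (Fin 2) (Fin 2) ℂ, (∀ b, w 1 b * ‖X b‖ < r₁) → ∀ c, ‖D X c‖ ≤ t)
    (huniq : ∀ X : PBond (F.P K) 0 → Matrix (Fin 2) (Fin 2) ℂ, (∀ b, w 1 b * ‖X b‖ < r₁) → ∀ D' : BondIdx Dm → Matrix (Fin 2) (Fin 2) ℂ, (∀ c, ‖D' c‖ ≤ t) → (fun (Z : PBond (F.P K) 0 → Matrix (Fin 2) (Fin 2) ℂ) => chartLogFlat ((((F.L : ℝ))⁻¹) ^ (K - n)) Dm Z - (fderiv ℂ (chartLogFlat ((((F.L : ℝ))⁻¹) ^ (K - n)) Dm : (PBond (F.P K) 0 → Matrix (Fin 2) (Fin 2) ℂ) → BondIdx Dm → Matrix (Fin 2) (Fin 2) ℂ) 0) Z) (X - H D') = D' → D' = D X)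
    (hDd : ∀ X : PBond (F.P K) 0 → Matrix (Fin 2) (Fin 2) ℂ, (∀ b, w 1 b * ‖X b‖ < r₁) → DifferentiableAt ℂ D X)
    (hball : ∀ X : PBond (F.P K) 0 → Matrix (Fin 2) (Fin 2) ℂ, (∀ b, w 1 b * ‖X b‖ < r₁) → ∀ b, w 1 b * ‖(X - H (D X)) b‖ < R)
    (Uc : (PBond (F.P K) 0 → Matrix (Fin 2) (Fin 2) ℂ) → GaugeField (F.P K) 0 (Matrix.specialUnitaryGroup (Fin 2) ℂ))
    (hUc : ∀ Y : PBond (F.P K) 0 → Matrix (Fin 2) (Fin 2) ℂ, (∀ b, IsSelfAdjoint (Y b)) → (∀ b, Matrix.trace (Y b) = 0) →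
      ∀ b, ((Uc Y b : Matrix.specialUnitaryGroup (Fin 2) ℂ) : Matrix (Fin 2) (Fin 2) ℂ) = exp ((Complex.I * (η : ℂ)) • Y b))
    {A : PBond (F.P K) 0 → Matrix (Fin 2) (Fin 2) ℂ} (hAsa : ∀ b, IsSelfAdjoint (A b)) (hAtr : ∀ b, Matrix.trace (A b) = 0) (hAS : ∀ b, w 1 b * ‖A b‖ < r₁)
    (hnK : n ≤ K) (ε₀ : ℝ) (V : GaugeField (F.P n) 0 (Matrix.specialUnitaryGroup (Fin 2) ℂ)) {Umin : GaugeField (F.P K) 0 (Matrix.specialUnitaryGroup (Fin 2) ℂ)}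
    (hcrit : IsMinOn (fun W : GaugeField (F.P K) 0 (Matrix.specialUnitaryGroup (Fin 2) ℂ) => wilsonAction4 W) (regFibrePr F n K hnK ε₀ V) Umin)
    (hHinv : ∀ Y : BondIdx Dm → Matrix (Fin 2) (Fin 2) ℂ, (fderiv ℂ (chartLogFlat ((((F.L : ℝ))⁻¹) ^ (K - n)) Dm : (PBond (F.P K) 0 → Matrix (Fin 2) (Fin 2) ℂ) → BondIdx Dm → Matrix (Fin 2) (Fin 2) ℂ) 0) (H Y) = Y)
    (Near : PBond (F.P K) 0 → Prop) [DecidablePred Near] (Tch : Plaq (F.P K) 0 → Prop)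
    (hTN : ∀ p : Plaq (F.P K) 0, Tch p → Near ⟨p.src, p.μ⟩ ∧ Near ⟨p.src.shift p.μ, p.ν⟩ ∧ Near ⟨p.src.shift p.ν, p.μ⟩ ∧ Near ⟨p.src, p.ν⟩)
    (hTF : ∀ p : Plaq (F.P K) 0, ¬ Tch p → Dm.LamBond 0 ⟨p.src, p.μ⟩ ∧ Dm.LamBond 0 ⟨p.src.shift p.μ, p.ν⟩ ∧ Dm.LamBond 0 ⟨p.src.shift p.ν, p.μ⟩ ∧ Dm.LamBond 0 ⟨p.src, p.ν⟩)
    (uS : GaugeTransf (F.P K) 0 (Matrix.specialUnitaryGroup (Fin 2) ℂ))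
    (hchartNear : ∀ b, Near b → ((GaugeField.gaugeAct uS Umin b : Matrix.specialUnitaryGroup (Fin 2) ℂ) : Matrix (Fin 2) (Fin 2) ℂ) = exp ((Complex.I * (η : ℂ)) • (A - H (D A)) b))
    (hΦ1 : ∀ X ∈ {X : PBond (F.P K) 0 → Matrix (Fin 2) (Fin 2) ℂ | (∀ b, IsSelfAdjoint (X b)) ∧ (∀ b, Matrix.trace (X b) = 0) ∧ (∀ c : BondIdx Dm, bondAvgIter (c.1.1 : ℕ) X c.1.2 = bondAvgIter (c.1.1 : ℕ) A c.1.2) ∧ X ∈ {Y : PBond (F.P K) 0 → Matrix (Fin 2) (Fin 2) ℂ | ∀ b, w 1 b * ‖Y b‖ < r₁}},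
      GaugeField.gaugeAct (fun z => (uS z)⁻¹) (fun b => if Near b then Uc (X - H (D X)) b else GaugeField.gaugeAct uS Umin b) ∈ regFibrePr F n K hnK ε₀ V) :
    ∀ s : PBond (F.P K) 0 → ℝ, QE Dm (WithLp.toLp 2 s) = 0 → ∀ Et : Matrix (Fin 2) (Fin 2) ℂ, IsSelfAdjoint Et → Matrix.trace Et = 0 →
    (((η : ℂ) ^ 2 / 2) * ∑ p : Plaq (F.P K) 0, Matrix.trace ((A ⟨p.src, p.μ⟩ + A ⟨p.src.shift p.μ, p.ν⟩ - A ⟨p.src.shift p.ν, p.μ⟩ - A ⟨p.src, p.ν⟩) * (((s ⟨p.src, p.μ⟩ : ℝ) : ℂ) • Et + ((s ⟨p.src.shift p.μ, p.ν⟩ : ℝ) : ℂ) • Et - ((s ⟨p.src.shift p.ν, p.μ⟩ : ℝ) : ℂ) • Et - ((s ⟨p.src, p.ν⟩ : ℝ) : ℂ) • Et)) +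
      (η : ℂ) ^ 4 * ∑ b : PBond (F.P K) 0, Matrix.trace ((W₀ (A - H (D A)) b + E A b) * (((s b : ℝ) : ℂ) • Et))).re = 0 := by
  have hw1 : ∀ b, 0 ≤ w 1 b := fun b => levWeight_nonneg hw 1 b
  set k : PBond (F.P K) 0 → BondIdx Dm → ℝ := fun b c => flatH F n K Dm (Pi.single c 1) b * ((F.L : ℝ) ^ (c.1.1 : ℕ) * ((F.L : ℝ)⁻¹) ^ (K - n))⁻¹ with hk
  have hHs' : ∀ X b, H X b = ∑ c, k b c • X c := hHs
  -- the dressed competitors are 𝔰𝔲(2)-valued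
  have hdress : ∀ X : PBond (F.P K) 0 → Matrix (Fin 2) (Fin 2) ℂ, (∀ b, IsSelfAdjoint (X b)) → (∀ b, Matrix.trace (X b) = 0) → (∀ b, w 1 b * ‖X b‖ < r₁) →
      (∀ b, IsSelfAdjoint ((X - H (D X)) b)) ∧ ∀ b, Matrix.trace ((X - H (D X)) b) = 0 := fun X hXsa hXtr hXS =>
    dressed_competitor_su2 F n K Dm hDk hcollar hw hR H k hHs' hXsa hXtr (hball X hXS) (h49 X hXS) (hsize X hXS) (huniq X hXS)
  have hdA := hdress A hAsa hAtr hAS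
  set T : Set (PBond (F.P K) 0 → Matrix (Fin 2) (Fin 2) ℂ) := {X : PBond (F.P K) 0 → Matrix (Fin 2) (Fin 2) ℂ | (∀ b, IsSelfAdjoint (X b)) ∧ (∀ b, Matrix.trace (X b) = 0) ∧
      (∀ c : BondIdx Dm, bondAvgIter (c.1.1 : ℕ) X c.1.2 = bondAvgIter (c.1.1 : ℕ) A c.1.2) ∧ X ∈ {Y : PBond (F.P K) 0 → Matrix (Fin 2) (Fin 2) ℂ | ∀ b, w 1 b * ‖Y b‖ < r₁}} with hT
  -- (a) the weight floor `η♭ ≤ w₁(b)` and the window `R ≤ 1/5`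
  have hL1 : (1 : ℝ) ≤ (F.L : ℝ) := by exact_mod_cast F.hL.2.le
  have hη0 : 0 ≤ ((F.L : ℝ))⁻¹ ^ (K - n) := pow_nonneg (inv_nonneg.2 (by positivity)) _
  have hwfloor : ∀ b : PBond (F.P K) 0, ((F.L : ℝ))⁻¹ ^ (K - n) ≤ w 1 b := fun b => by
    rw [hw 1 b, pow_one]
    exact le_mul_of_one_le_left hη0 (one_le_pow₀ hL1)
  have hR5 : R ≤ 1 / 5 := by
    by_cases hR0 : R ≤ 0
    · linarith
    have hR0' : 0 < R := lt_of_not_ge hR0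
    have hc : (1 : ℝ) ≤ ((((F.P K).d + 2) * (F.P K).L : ℕ) : ℝ) := by
      exact_mod_cast Nat.succ_le_of_lt (Nat.mul_pos (by omega) (F.P K).L_pos)
    have hc2 : (1 : ℝ) ≤ ((((F.P K).d + 2) * (F.P K).L : ℕ) : ℝ) ^ 2 * (F.L : ℝ) := one_le_mul_of_one_le_of_one_le (one_le_pow₀ hc) hL1
    have h1 : 16 * 3800 * R ≤ 16 * 3800 * ((((F.P K).d + 2) * (F.P K).L : ℕ) : ℝ) ^ 2 * (F.L : ℝ) * R := by nlinarith
    linarith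
  -- (b) PINNING: a level-0 index datum is the bond value, so every competitor equals `A` on `Λ₀`
  have hpin : ∀ X ∈ T, ∀ (b : PBond (F.P K) 0) (hb : Dm.LamBond 0 b), X b = A b := fun X hX b hb => by
    have h := hX.2.2.1 ⟨⟨⟨0, Nat.succ_pos _⟩, b⟩, hb⟩
    simpa only [bondAvgIter_zero] using h
  -- (c) THE LEVEL-0 DRESSING VANISHES on the ball ((49) at a level-0 index; `logTower_zero`)
  have hD0 : ∀ Y : PBond (F.P K) 0 → Matrix (Fin 2) (Fin 2) ℂ, (∀ b, w 1 b * ‖Y b‖ < r₁) → ∀ (b : PBond (F.P K) 0) (hb : Dm.LamBond 0 b),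
      D Y ⟨⟨⟨0, Nat.succ_pos _⟩, b⟩, hb⟩ = 0 := fun Y hY b hb => by
    have hsmall : ‖((((((F.L : ℝ))⁻¹ ^ (K - n) : ℝ)) : ℂ) • (Y - H (D Y))) b‖ ≤ 1 / 5 := by
      rw [Pi.smul_apply, norm_smul, Complex.norm_real, Real.norm_of_nonneg hη0]
      have h1 : ((F.L : ℝ))⁻¹ ^ (K - n) * ‖(Y - H (D Y)) b‖ ≤ w 1 b * ‖(Y - H (D Y)) b‖ := mul_le_mul_of_nonneg_right (hwfloor b) (norm_nonneg _)
      linarith [hball Y hY b]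
    have h := congr_fun (h49 Y hY) ⟨⟨⟨0, Nat.succ_pos _⟩, b⟩, hb⟩
    simp only [Pi.sub_apply] at h
    rw [fderiv_chartLogFlat_zero_apply, chartLogFlat_apply] at h
    have h' : (-Complex.I) • MatrixLog.mlog (((Prop8ChartDoubleBar.dbarIterU 0 (Prop8Chart.expCfg (((F.L : ℝ))⁻¹ ^ (K - n)) (Y - H (D Y)))) b :
        (Matrix (Fin 2) (Fin 2) ℂ)ˣ) : Matrix (Fin 2) (Fin 2) ℂ) -
        ((((((F.L : ℝ))⁻¹ ^ (K - n) : ℝ)) : ℂ) * (((F.P K).L : ℕ) : ℂ) ^ (0 : ℕ)) • bondAvgIter 0 (Y - H (D Y)) b = D Y ⟨⟨⟨0, Nat.succ_pos _⟩, b⟩, hb⟩ := h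
    rw [ChartKernelFlat.logTower_zero _ _ b hsmall, pow_zero, mul_one, bondAvgIter_zero, Pi.smul_apply, sub_self] at h'
    exact h'.symm
  -- `H` at a level-0 bond reads the level-0 datum (`hHinv` at level 0), so the dressing disappears from the dressed competitor on `Λ₀`
  have hHD0 : ∀ Y : PBond (F.P K) 0 → Matrix (Fin 2) (Fin 2) ℂ, (∀ b, w 1 b * ‖Y b‖ < r₁) → ∀ (b : PBond (F.P K) 0), Dm.LamBond 0 b → H (D Y) b = 0 :=
      fun Y hY b hb => by
    have h := congr_fun (hHinv (D Y)) ⟨⟨⟨0, Nat.succ_pos _⟩, b⟩, hb⟩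
    rw [fderiv_chartLogFlat_zero_apply] at h
    have h' : ((((((F.L : ℝ))⁻¹ ^ (K - n) : ℝ)) : ℂ) * (((F.P K).L : ℕ) : ℂ) ^ (0 : ℕ)) • bondAvgIter 0 (H (D Y)) b = D Y ⟨⟨⟨0, Nat.succ_pos _⟩, b⟩, hb⟩ := h
    rw [pow_zero, mul_one, bondAvgIter_zero, hD0 Y hY b hb, smul_eq_zero] at h'
    have hLpos : (0 : ℝ) < (F.L : ℝ) := by linarith
    have hηne : ((((F.L : ℝ))⁻¹ ^ (K - n) : ℝ) : ℂ) ≠ 0 := by exact_mod_cast (pow_pos (inv_pos.2 hLpos) (K - n)).ne'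
    exact h'.resolve_left hηne
  have hZ : ∀ X ∈ T, ∀ (b : PBond (F.P K) 0), Dm.LamBond 0 b → (X - H (D X)) b = (A - H (D A)) b := fun X hX b hb => by
    rw [Pi.sub_apply, Pi.sub_apply, hHD0 X hX.2.2.2 b hb, hHD0 A hAS b hb, hpin X hX b hb]
  -- (d) the local competitor map
  obtain ⟨Φloc, hΦloc⟩ : ∃ Φ : (PBond (F.P K) 0 → Matrix (Fin 2) (Fin 2) ℂ) → GaugeField (F.P K) 0 (Matrix.specialUnitaryGroup (Fin 2) ℂ),
      ∀ X b, Φ X b = if Near b then Uc (X - H (D X)) b else GaugeField.gaugeAct uS Umin b := ⟨fun X b => if Near b then Uc (X - H (D X)) b else GaugeField.gaugeAct uS Umin b, fun _ _ => rfl⟩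
  have hΦfun : ∀ X, Φloc X = fun b => if Near b then Uc (X - H (D X)) b else GaugeField.gaugeAct uS Umin b := fun X => funext (hΦloc X)
  -- the chart point hits the minimiser's gauge copy (REGIONAL chart identity on the Near bonds, the copy itself elsewhere)
  have hΦA : Φloc A = GaugeField.gaugeAct uS Umin := by
    funext b
    rw [hΦloc]
    by_cases hNb : Near b
    · rw [if_pos hNb]
      exact Subtype.ext (by rw [hUc _ hdA.1 hdA.2 b, hchartNear b hNb])
    · rw [if_neg hNb]
  have hΦ'A : GaugeField.gaugeAct (fun z => (uS z)⁻¹) (Φloc A) = Umin := by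
    rw [hΦA]
    funext b
    simp only [GaugeField.gaugeAct, inv_inv]
    group
  -- minimality: through the pulled-back map `uS⁻¹ • Φloc` (values in the ORIGINAL fibre), then gauge invariance of the Wilson action
  have hΦ1' : ∀ X ∈ T, GaugeField.gaugeAct (fun z => (uS z)⁻¹) (Φloc X) ∈ regFibrePr F n K hnK ε₀ V := fun X hX => by
    rw [hΦfun X]; exact hΦ1 X hX
  have hminΦ' := HalvingHcritTransfer.hmin_of_hcrit_eq hnK ε₀ V hcrit T (fun X => GaugeField.gaugeAct (fun z => (uS z)⁻¹) (Φloc X)) hΦ1' hΦ'A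
  have hga : ∀ X, wilsonAction4 (GaugeField.gaugeAct (fun z => (uS z)⁻¹) (Φloc X)) = wilsonAction4 (Φloc X) := fun X =>
    T4WilsonGaugeFlatDirection.wilsonAction_gaugeAct 1 _ _
  have hminΦ : IsMinOn (fun X => wilsonAction4 (Φloc X)) T A := by
    refine isMinOn_iff.mpr fun X hX => ?_
    have h := isMinOn_iff.mp hminΦ' X hX
    rwa [hga, hga] at h
  -- the chart on the sides of the `Tch`-plaquettes
  have hexp : ∀ X ∈ T, ∀ p : Plaq (F.P K) 0, Tch p →
      ((Φloc X ⟨p.src, p.μ⟩ : Matrix.specialUnitaryGroup (Fin 2) ℂ) : Matrix (Fin 2) (Fin 2) ℂ) = exp ((Complex.I * (η : ℂ)) • (X - H (D X)) ⟨p.src, p.μ⟩) ∧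
      ((Φloc X ⟨p.src.shift p.μ, p.ν⟩ : Matrix.specialUnitaryGroup (Fin 2) ℂ) : Matrix (Fin 2) (Fin 2) ℂ) = exp ((Complex.I * (η : ℂ)) • (X - H (D X)) ⟨p.src.shift p.μ, p.ν⟩) ∧
      ((Φloc X ⟨p.src.shift p.ν, p.μ⟩ : Matrix.specialUnitaryGroup (Fin 2) ℂ) : Matrix (Fin 2) (Fin 2) ℂ) = exp ((Complex.I * (η : ℂ)) • (X - H (D X)) ⟨p.src.shift p.ν, p.μ⟩) ∧
      ((Φloc X ⟨p.src, p.ν⟩ : Matrix.specialUnitaryGroup (Fin 2) ℂ) : Matrix (Fin 2) (Fin 2) ℂ) = exp ((Complex.I * (η : ℂ)) • (X - H (D X)) ⟨p.src, p.ν⟩) := by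
    intro X hX p hp
    obtain ⟨h1, h2, h3, h4⟩ := hTN p hp
    have hd := hdress X hX.1 hX.2.1 hX.2.2.2
    have hc : ∀ b, Near b → ((Φloc X b : Matrix.specialUnitaryGroup (Fin 2) ℂ) : Matrix (Fin 2) (Fin 2) ℂ) = exp ((Complex.I * (η : ℂ)) • (X - H (D X)) b) :=
      fun b hb => by rw [hΦloc, if_pos hb]; exact hUc _ hd.1 hd.2 b
    exact ⟨hc _ h1, hc _ h2, hc _ h3, hc _ h4⟩
  -- off the `Tch`-plaquettes the competitor and its dressed field are those of `A` (pinning + level-0 dressing)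
  have hoff : ∀ X ∈ T, ∀ p : Plaq (F.P K) 0, ¬ Tch p →
      (Φloc X ⟨p.src, p.μ⟩ = Φloc A ⟨p.src, p.μ⟩ ∧ Φloc X ⟨p.src.shift p.μ, p.ν⟩ = Φloc A ⟨p.src.shift p.μ, p.ν⟩ ∧
        Φloc X ⟨p.src.shift p.ν, p.μ⟩ = Φloc A ⟨p.src.shift p.ν, p.μ⟩ ∧ Φloc X ⟨p.src, p.ν⟩ = Φloc A ⟨p.src, p.ν⟩) ∧
      ((X - H (D X)) ⟨p.src, p.μ⟩ = (A - H (D A)) ⟨p.src, p.μ⟩ ∧ (X - H (D X)) ⟨p.src.shift p.μ, p.ν⟩ = (A - H (D A)) ⟨p.src.shift p.μ, p.ν⟩ ∧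
        (X - H (D X)) ⟨p.src.shift p.ν, p.μ⟩ = (A - H (D A)) ⟨p.src.shift p.ν, p.μ⟩ ∧ (X - H (D X)) ⟨p.src, p.ν⟩ = (A - H (D A)) ⟨p.src, p.ν⟩) := by
    intro X hX p hp
    obtain ⟨h1, h2, h3, h4⟩ := hTF p hp
    have hdX := hdress X hX.1 hX.2.1 hX.2.2.2
    have hΦb : ∀ b : PBond (F.P K) 0, Dm.LamBond 0 b → Φloc X b = Φloc A b := fun b hb => by
      rw [hΦloc, hΦloc]
      by_cases hNb : Near b
      · rw [if_pos hNb, if_pos hNb]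
        exact Subtype.ext (by rw [hUc _ hdX.1 hdX.2 b, hUc _ hdA.1 hdA.2 b, hZ X hX b hb])
      · rw [if_neg hNb, if_neg hNb]
    exact ⟨⟨hΦb _ h1, hΦb _ h2, hΦb _ h3, hΦb _ h4⟩, ⟨hZ X hX _ h1, hZ X hX _ h2, hZ X hX _ h3, hZ X hX _ h4⟩⟩
  -- FILE A §4
  refine HalvingCompetitorMapAction.tracePairing_of_isMinOn_localChart Dm η hη W₀ hSd hgrad H D E hE
    (S₀ := {Y : PBond (F.P K) 0 → Matrix (Fin 2) (Fin 2) ℂ | ∀ b, w 1 b * ‖Y b‖ < r₁}) (Bdat := fun c => bondAvgIter (c.1.1 : ℕ) A c.1.2) Tch Φloc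
    (fun X hX => (hdress X hX.1 hX.2.1 hX.2.2.2).1) hexp hoff hAsa hAtr (fun c => rfl) hAS (fun δ => ?_) (hDd A hAS) hminΦ
  obtain ⟨r, hr, h⟩ := exists_lineRadius_of_mem_weightedBall (w 1) hw1 hAS δ
  exact ⟨r, hr, fun t ht => h t ht⟩

end Summit.QuantumFields.YangMills.Theorems.HalvingSitePackage

end
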